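import Summits.Parity.GeneralizedHardyLittlewood.Theorems.BeyondDiagonalBeatsQuarter.OffDiagDualHyperbolaCentred
import HarnessLib

/-!
# Route `PrimeLevelFamEdge`, crux K_B (stmt-Parity-20343), line `diagonal_kernel_split` rev 4, plan Ω,
# worker key L3 (part 6b) `OffDiagDualBoxSizeBessel`: the bulk of a dual box with the Bessel factor sized on the
# WHOLE box `x ∈ [Z/2, 2Z]` — `|J₁(x)| ≤ 140·Z·(1+Z)^{−3/2}` — so that the layers `r` with `Z ≍ q̂^{η}/r ≪ 1`
# carry the factor `Z ∝ 1/r` (the `r`-sum of the trivial ledger is then `≍ log q`, not `q⁷`)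

L3 part 1 (`OffDiagDualBoxSize`) bounds the layer weight `g` on a box using a bound `J` for `|J₁(x)|` on
`x ≥ Z/2` only (`J = 1` or the Hankel size `35(Z/2)^{−1/2}`). On the box the Bessel argument also satisfies
`x ≤ 2Z` (`y_j < 2K_j`), and for small `Z` the right size is `|J₁(x)| ≤ x/2 ≤ Z`. This file:
* §1 `abs_besselJ_one_le_box`: for `Z > 0` and `Z/2 ≤ x ≤ 2Z`, `|J₁(x)| ≤ 140·Z·(1+Z)^{−3/2}` (from `|J₁(x)| ≤ x/2`
  for `Z ≤ 1` and `|J₁(x)| ≤ 35x^{−1/2}` for `Z ≥ 1`; one algebraic majorant for both regimes, with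
  `(1+Z)²·J = 140·Z(1+Z)^{1/2}`);
* §2 `abs_layerWeightR_le_of_mem_box`, `norm_boxWeight_le_of_twoSided`, **`norm_fourier2_boxWeight_le_twoSided`**:
  the sup / bulk bounds of part 1 under a TWO-SIDED Bessel hypothesis `∀ x ∈ [Z/2, 2Z], |J₁(x)| ≤ J`;
* §3 **`norm_fourier2_boxWeight_le_bessel`** (`J = 140Z(1+Z)^{−3/2}`) and the per-box trivial ledger
  **`sum_dualBox_norm_le_bessel`** = `sum_dualBox_norm_le_centred` with this `J`:
  `Σ_{box} ‖Φ̂_i(h/(qr))‖·N ≤ (9/4)K₁K₂(d₁d₂K₁K₂/4)^{−1/2}W(X/4)r⁻¹·140Z(1+Z)^{−3/2} · gcd(α,qr)(2A₁A₂/(qr)+1)·2C(A₁A₂)^δ`.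
Absolute values only; nothing about the heart. Helper (`--supports stmt-Parity-20343`); standard axioms.
«The programme SEARCHES and TYPES; no claim about Landau–Siegel zeros, Theorems 1–2 of arXiv:2211.02515 or
a repaired Margin232 until a kernel theorem says so.»
-/

noncomputable section

open Set MeasureTheory Finset
open scoped Real

namespace Summit.Parity.GeneralizedHardyLittlewood.Theorems.BeyondDiagonalBeatsQuarter.OffDiag

open Literature.NumberTheory.LFunctions Literature.NumberTheory.LFunctions.KMV2000
open Literature.Analysis.FunctionSpaces (besselJ abs_besselJ_one_le_one abs_besselJ_one_le_half_mul)
open Literature.Analysis.Calculus.WhitneyConvex (dyadicBump dyadicBump_nonneg dyadicBump_le_one)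
open Literature.NumberTheory.Sieve.FriedlanderIwaniecPrimes (fourier2 BoxSupport norm_fourier2_le)

/-! ### §1. One Bessel size for the whole box -/

/-- **`|J₁(x)| ≤ 140·Z·(1+Z)^{−3/2}` for `Z > 0`, `Z/2 ≤ x ≤ 2Z`.** (`Z ≤ 1`: `|J₁(x)| ≤ x/2 ≤ Z` and
`(1+Z)^{3/2} ≤ 2^{3/2} < 140`; `Z ≥ 1`: `|J₁(x)| ≤ 35x^{−1/2} ≤ 35√2·Z^{−1/2}` and `(1+Z)^{3/2} ≤ (2Z)^{3/2}`.)
[cite: Iwaniec2002, Appendix B.4 (B.35) — derivation] -/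
theorem abs_besselJ_one_le_box {Z x : ℝ} (hZ : 0 < Z) (hx1 : Z / 2 ≤ x) (hx2 : x ≤ 2 * Z) :
    |besselJ 1 x| ≤ 140 * Z * (1 + Z) ^ (-(3 / 2 : ℝ)) := by
  have hx0 : 0 < x := lt_of_lt_of_le (by positivity) hx1
  have h1Z : 0 < 1 + Z := by linarith
  have hpow : (1 + Z) ^ (-(3 / 2 : ℝ)) = ((1 + Z) ^ (3 / 2 : ℝ))⁻¹ := Real.rpow_neg h1Z.le _
  have h32 : 0 < (1 + Z) ^ (3 / 2 : ℝ) := Real.rpow_pos_of_pos h1Z _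
  rw [hpow, show 140 * Z * ((1 + Z) ^ (3 / 2 : ℝ))⁻¹ = 140 * Z / (1 + Z) ^ (3 / 2 : ℝ) by ring,
    le_div_iff₀ h32]
  rcases le_or_gt Z 1 with hZ1 | hZ1
  · -- small `Z`: `|J₁(x)| (1+Z)^{3/2} ≤ Z · 2^{3/2} ≤ 140 Z`
    have hJ : |besselJ 1 x| ≤ Z := by
      have := abs_besselJ_one_le_half_mul hx0.le; linarith
    have h2 : (1 + Z) ^ (3 / 2 : ℝ) ≤ (2 : ℝ) ^ (3 / 2 : ℝ) :=
      Real.rpow_le_rpow h1Z.le (by linarith) (by norm_num)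
    have h3 : (2 : ℝ) ^ (3 / 2 : ℝ) ≤ 2 ^ (2 : ℝ) :=
      Real.rpow_le_rpow_of_exponent_le (by norm_num) (by norm_num)
    have h4 : (2 : ℝ) ^ (2 : ℝ) = 4 := by norm_num
    calc |besselJ 1 x| * (1 + Z) ^ (3 / 2 : ℝ) ≤ Z * 4 := by
          refine mul_le_mul hJ (h2.trans (h3.trans h4.le)) h32.le hZ.le
      _ ≤ 140 * Z := by linarith
  · -- large `Z`: `|J₁(x)| ≤ 35 x^{-1/2} ≤ 35 (Z/2)^{-1/2}`, `(1+Z)^{3/2} ≤ (2Z)^{3/2} = 2√2 Z^{3/2}`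
    have hJ : |besselJ 1 x| ≤ 35 * (Z / 2) ^ (-(1 / 2 : ℝ)) :=
      (abs_besselJ_one_le_rpow hx0).trans
        (mul_le_mul_of_nonneg_left (Real.rpow_le_rpow_of_nonpos (by positivity) hx1 (by norm_num))
          (by norm_num))
    have h2 : (1 + Z) ^ (3 / 2 : ℝ) ≤ (2 * Z) ^ (3 / 2 : ℝ) :=
      Real.rpow_le_rpow h1Z.le (by linarith) (by norm_num)
    -- `(Z/2)^{-1/2} (2Z)^{3/2} = 4 Z`
    have hprod : (Z / 2) ^ (-(1 / 2 : ℝ)) * (2 * Z) ^ (3 / 2 : ℝ) = 4 * Z := by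
      rw [show (2 * Z : ℝ) = (Z / 2) * 4 by ring, Real.mul_rpow (by positivity) (by norm_num),
        ← mul_assoc, ← Real.rpow_add (by positivity : (0 : ℝ) < Z / 2)]
      rw [show (-(1 / 2 : ℝ) + 3 / 2) = 1 by norm_num, Real.rpow_one,
        show (4 : ℝ) ^ (3 / 2 : ℝ) = 8 by
          rw [show (4 : ℝ) = 2 ^ (2 : ℝ) by norm_num, ← Real.rpow_mul (by norm_num)]; norm_num]
      ring
    calc |besselJ 1 x| * (1 + Z) ^ (3 / 2 : ℝ)
        ≤ (35 * (Z / 2) ^ (-(1 / 2 : ℝ))) * (2 * Z) ^ (3 / 2 : ℝ) := mul_le_mul hJ h2 h32.le (by positivity)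
      _ = 35 * ((Z / 2) ^ (-(1 / 2 : ℝ)) * (2 * Z) ^ (3 / 2 : ℝ)) := by ring
      _ = 140 * Z := by rw [hprod]; ring

/-! ### §2. Sup and bulk under a two-sided Bessel hypothesis -/

section TwoSided

variable {q d₁ d₂ α β r : ℕ}

/-- **Sup of the layer weight on the box `K_j/2 < y_j < 2K_j`**, with a bound `J` for `|J₁(x)|` on
`Z/2 ≤ x ≤ 2Z`, `Z = 4π√(αβK₁K₂)/(qr)`: `|g(y)| ≤ (d₁d₂K₁K₂/4)^{−1/2}·W(d₁d₂K₁K₂/(4q̂²))·r⁻¹·J`.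
[cite: KowalskiMichelVanderKam2000, (21)–(22) p. 12; KowalskiMichel2000, §2.4.2 p. 312 — derivation] -/
theorem abs_layerWeightR_le_of_mem_box [NeZero q] (hd₁ : 1 ≤ d₁) (hd₂ : 1 ≤ d₂) {K₁ K₂ : ℝ} (hK₁ : 0 < K₁)
    (hK₂ : 0 < K₂) {J : ℝ}
    (hJ : ∀ x : ℝ, 4 * π * Real.sqrt ((α : ℝ) * (β : ℝ) * (K₁ * K₂)) / ((q : ℝ) * r) / 2 ≤ x →
      x ≤ 2 * (4 * π * Real.sqrt ((α : ℝ) * (β : ℝ) * (K₁ * K₂)) / ((q : ℝ) * r)) → |besselJ 1 x| ≤ J)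
    {y : ℝ × ℝ} (hy₁ : K₁ / 2 < y.1) (hy₁' : y.1 < 2 * K₁) (hy₂ : K₂ / 2 < y.2) (hy₂' : y.2 < 2 * K₂) :
    |layerWeightR q d₁ d₂ α β r y| ≤
      ((d₁ : ℝ) * d₂ * (K₁ * K₂) / 4) ^ (-(1 / 2 : ℝ)) * cutoffW ((d₁ : ℝ) * d₂ * (K₁ * K₂) / 4 / qhat q ^ 2) *
        (r : ℝ)⁻¹ * J := by
  have hQ : 0 < qhat q := qhat_pos_of_neZero q
  have hd₁0 : (0 : ℝ) < d₁ := by exact_mod_cast hd₁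
  have hd₂0 : (0 : ℝ) < d₂ := by exact_mod_cast hd₂
  have hy1 : 0 < y.1 := lt_trans (by positivity) hy₁
  have hy2 : 0 < y.2 := lt_trans (by positivity) hy₂
  set P : ℝ := (d₁ : ℝ) * y.1 * ((d₂ : ℝ) * y.2) with hP
  have hP0 : 0 < P := by positivity
  have hB0 : 0 < (d₁ : ℝ) * d₂ * (K₁ * K₂) / 4 := by positivity
  have hPB : (d₁ : ℝ) * d₂ * (K₁ * K₂) / 4 ≤ P := by
    have h12 : K₁ / 2 * (K₂ / 2) ≤ y.1 * y.2 := mul_le_mul hy₁.le hy₂.le (by positivity) hy1.le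
    calc (d₁ : ℝ) * d₂ * (K₁ * K₂) / 4 = (d₁ : ℝ) * d₂ * (K₁ / 2 * (K₂ / 2)) := by ring
      _ ≤ (d₁ : ℝ) * d₂ * (y.1 * y.2) := mul_le_mul_of_nonneg_left h12 (by positivity)
      _ = P := by rw [hP]; ring
  have h1 : P ^ (-(1 / 2 : ℝ)) ≤ ((d₁ : ℝ) * d₂ * (K₁ * K₂) / 4) ^ (-(1 / 2 : ℝ)) :=
    Real.rpow_le_rpow_of_nonpos hB0 hPB (by norm_num)
  have h2 : cutoffW (P / qhat q ^ 2) ≤ cutoffW ((d₁ : ℝ) * d₂ * (K₁ * K₂) / 4 / qhat q ^ 2) :=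
    cutoffW_antitoneOn (show (0 : ℝ) ≤ _ by positivity) (show (0 : ℝ) ≤ P / qhat q ^ 2 by positivity)
      (div_le_div_of_nonneg_right hPB (by positivity))
  -- the Bessel argument lies in `[Z/2, 2Z]`
  have h4 : Real.sqrt 4 = 2 := by
    rw [show (4 : ℝ) = 2 ^ 2 by norm_num, Real.sqrt_sq (by norm_num)]
  have hlow : 4 * π * Real.sqrt ((α : ℝ) * (β : ℝ) * (K₁ * K₂)) / ((q : ℝ) * r) / 2 ≤
      4 * π * Real.sqrt ((α : ℝ) * y.1 * ((β : ℝ) * y.2)) / ((q : ℝ) * r) := by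
    have hs : Real.sqrt ((α : ℝ) * (β : ℝ) * (K₁ * K₂)) / 2 ≤ Real.sqrt ((α : ℝ) * y.1 * ((β : ℝ) * y.2)) := by
      rw [← h4, ← Real.sqrt_div (by positivity)]
      refine Real.sqrt_le_sqrt ?_
      rw [div_le_iff₀ (by norm_num)]
      have h12 : K₁ * K₂ ≤ y.1 * y.2 * 4 := by nlinarith
      calc (α : ℝ) * β * (K₁ * K₂) ≤ (α : ℝ) * β * (y.1 * y.2 * 4) :=
            mul_le_mul_of_nonneg_left h12 (by positivity)
        _ = (α : ℝ) * y.1 * ((β : ℝ) * y.2) * 4 := by ring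
    calc 4 * π * Real.sqrt ((α : ℝ) * (β : ℝ) * (K₁ * K₂)) / ((q : ℝ) * r) / 2
        = 4 * π * (Real.sqrt ((α : ℝ) * (β : ℝ) * (K₁ * K₂)) / 2) / ((q : ℝ) * r) := by ring
      _ ≤ 4 * π * Real.sqrt ((α : ℝ) * y.1 * ((β : ℝ) * y.2)) / ((q : ℝ) * r) := by gcongr
  have hup : 4 * π * Real.sqrt ((α : ℝ) * y.1 * ((β : ℝ) * y.2)) / ((q : ℝ) * r) ≤
      2 * (4 * π * Real.sqrt ((α : ℝ) * (β : ℝ) * (K₁ * K₂)) / ((q : ℝ) * r)) := by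
    have hs : Real.sqrt ((α : ℝ) * y.1 * ((β : ℝ) * y.2)) ≤ 2 * Real.sqrt ((α : ℝ) * (β : ℝ) * (K₁ * K₂)) := by
      rw [← h4, ← Real.sqrt_mul (by norm_num)]
      refine Real.sqrt_le_sqrt ?_
      have h12 : y.1 * y.2 ≤ 4 * (K₁ * K₂) := by nlinarith
      calc (α : ℝ) * y.1 * ((β : ℝ) * y.2) = (α : ℝ) * β * (y.1 * y.2) := by ring
        _ ≤ (α : ℝ) * β * (4 * (K₁ * K₂)) := mul_le_mul_of_nonneg_left h12 (by positivity)
        _ = 4 * ((α : ℝ) * β * (K₁ * K₂)) := by ring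
    calc 4 * π * Real.sqrt ((α : ℝ) * y.1 * ((β : ℝ) * y.2)) / ((q : ℝ) * r)
        ≤ 4 * π * (2 * Real.sqrt ((α : ℝ) * (β : ℝ) * (K₁ * K₂))) / ((q : ℝ) * r) := by gcongr
      _ = _ := by ring
  have h3 : |besselJ 1 (4 * π * Real.sqrt ((α : ℝ) * y.1 * ((β : ℝ) * y.2)) / ((q : ℝ) * r))| ≤ J :=
    hJ _ hlow hup
  have hWP : 0 ≤ cutoffW (P / qhat q ^ 2) := cutoffW_nonneg _
  have hWB : 0 ≤ cutoffW ((d₁ : ℝ) * d₂ * (K₁ * K₂) / 4 / qhat q ^ 2) := cutoffW_nonneg _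
  have hr0 : (0 : ℝ) ≤ (r : ℝ)⁻¹ := by positivity
  unfold layerWeightR
  rw [← hP, abs_mul, abs_mul, abs_mul, abs_of_nonneg (Real.rpow_nonneg hP0.le _),
    abs_of_nonneg hWP, abs_of_nonneg hr0]
  exact mul_le_mul (mul_le_mul_of_nonneg_right (mul_le_mul h1 h2 hWP (by positivity)) hr0) h3
    (abs_nonneg _) (by positivity)

/-- **The box weight at every point, two-sided Bessel hypothesis** (`K_j = 2^{i_j}`):
`‖Φ_i(t₁,t₂)‖ ≤ (d₁d₂K₁K₂/4)^{−1/2}·W(d₁d₂K₁K₂/(4q̂²))·r⁻¹·J` for all `t` (`J ≥ 0`).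
[cite: KowalskiMichelVanderKam2000, (21)–(22) p. 12 — derivation] -/
theorem norm_boxWeight_le_of_twoSided [NeZero q] (hd₁ : 1 ≤ d₁) (hd₂ : 1 ≤ d₂) (i : ℕ × ℕ) {J : ℝ}
    (hJ0 : 0 ≤ J)
    (hJ : ∀ x : ℝ, 4 * π * Real.sqrt ((α : ℝ) * (β : ℝ) * ((2 : ℝ) ^ i.1 * 2 ^ i.2)) / ((q : ℝ) * r) / 2 ≤ x →
      x ≤ 2 * (4 * π * Real.sqrt ((α : ℝ) * (β : ℝ) * ((2 : ℝ) ^ i.1 * 2 ^ i.2)) / ((q : ℝ) * r)) →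
        |besselJ 1 x| ≤ J) (t₁ t₂ : ℝ) :
    ‖boxWeight q d₁ d₂ α β r i t₁ t₂‖ ≤
      ((d₁ : ℝ) * d₂ * ((2 : ℝ) ^ i.1 * 2 ^ i.2) / 4) ^ (-(1 / 2 : ℝ)) *
        cutoffW ((d₁ : ℝ) * d₂ * ((2 : ℝ) ^ i.1 * 2 ^ i.2) / 4 / qhat q ^ 2) * (r : ℝ)⁻¹ * J := by
  have hS0 : 0 ≤ ((d₁ : ℝ) * d₂ * ((2 : ℝ) ^ i.1 * 2 ^ i.2) / 4) ^ (-(1 / 2 : ℝ)) *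
      cutoffW ((d₁ : ℝ) * d₂ * ((2 : ℝ) ^ i.1 * 2 ^ i.2) / 4 / qhat q ^ 2) * (r : ℝ)⁻¹ * J := by
    have := cutoffW_nonneg ((d₁ : ℝ) * d₂ * ((2 : ℝ) ^ i.1 * 2 ^ i.2) / 4 / qhat q ^ 2)
    positivity
  by_cases hθ : dyadicBump (t₁ / 2 ^ i.1) * dyadicBump (t₂ / 2 ^ i.2) = 0
  · rw [boxWeight, hθ, Complex.ofReal_zero, zero_mul, norm_zero]; exact hS0
  obtain ⟨⟨h1, h1'⟩, ⟨h2, h2'⟩⟩ := mem_box_of_bump₂_ne_zero hθ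
  have hθle : dyadicBump (t₁ / 2 ^ i.1) * dyadicBump (t₂ / 2 ^ i.2) ≤ 1 :=
    mul_le_one₀ (dyadicBump_le_one _) (dyadicBump_nonneg _) (dyadicBump_le_one _)
  have hθnn : 0 ≤ dyadicBump (t₁ / 2 ^ i.1) * dyadicBump (t₂ / 2 ^ i.2) :=
    mul_nonneg (dyadicBump_nonneg _) (dyadicBump_nonneg _)
  have hg := abs_layerWeightR_le_of_mem_box (q := q) (α := α) (β := β) (r := r) hd₁ hd₂
    (by positivity : (0 : ℝ) < 2 ^ i.1) (by positivity : (0 : ℝ) < 2 ^ i.2) hJ (y := (t₁, t₂)) h1 h1' h2 h2'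
  rw [boxWeight, norm_mul, Complex.norm_real, Complex.norm_real, Real.norm_of_nonneg hθnn, Real.norm_eq_abs]
  calc dyadicBump (t₁ / 2 ^ i.1) * dyadicBump (t₂ / 2 ^ i.2) * |layerWeightR q d₁ d₂ α β r (t₁, t₂)|
      ≤ 1 * (((d₁ : ℝ) * d₂ * ((2 : ℝ) ^ i.1 * 2 ^ i.2) / 4) ^ (-(1 / 2 : ℝ)) *
          cutoffW ((d₁ : ℝ) * d₂ * ((2 : ℝ) ^ i.1 * 2 ^ i.2) / 4 / qhat q ^ 2) * (r : ℝ)⁻¹ * J) :=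
        mul_le_mul hθle hg (abs_nonneg _) zero_le_one
    _ = _ := one_mul _

/-- **Bulk under the two-sided Bessel hypothesis**: `‖Φ̂_i(ξ)‖ ≤ (9/4)K₁K₂·(d₁d₂K₁K₂/4)^{−1/2}W(…)r⁻¹J`.
[cite: KowalskiMichelVanderKam2000, (21)–(23) p. 12 and Lemma 3.3 p. 9 — derivation] -/
theorem norm_fourier2_boxWeight_le_twoSided [NeZero q] (hd₁ : 1 ≤ d₁) (hd₂ : 1 ≤ d₂) (hα : 1 ≤ α)
    (hβ : 1 ≤ β) (i : ℕ × ℕ) {J : ℝ} (hJ0 : 0 ≤ J)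
    (hJ : ∀ x : ℝ, 4 * π * Real.sqrt ((α : ℝ) * (β : ℝ) * ((2 : ℝ) ^ i.1 * 2 ^ i.2)) / ((q : ℝ) * r) / 2 ≤ x →
      x ≤ 2 * (4 * π * Real.sqrt ((α : ℝ) * (β : ℝ) * ((2 : ℝ) ^ i.1 * 2 ^ i.2)) / ((q : ℝ) * r)) →
        |besselJ 1 x| ≤ J) (ξ₁ ξ₂ : ℝ) :
    ‖fourier2 (boxWeight q d₁ d₂ α β r i) ξ₁ ξ₂‖ ≤
      9 / 4 * ((2 : ℝ) ^ i.1 * 2 ^ i.2) *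
        (((d₁ : ℝ) * d₂ * ((2 : ℝ) ^ i.1 * 2 ^ i.2) / 4) ^ (-(1 / 2 : ℝ)) *
          cutoffW ((d₁ : ℝ) * d₂ * ((2 : ℝ) ^ i.1 * 2 ^ i.2) / 4 / qhat q ^ 2) * (r : ℝ)⁻¹ * J) := by
  have hS0 : 0 ≤ ((d₁ : ℝ) * d₂ * ((2 : ℝ) ^ i.1 * 2 ^ i.2) / 4) ^ (-(1 / 2 : ℝ)) *
      cutoffW ((d₁ : ℝ) * d₂ * ((2 : ℝ) ^ i.1 * 2 ^ i.2) / 4 / qhat q ^ 2) * (r : ℝ)⁻¹ * J := by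
    have := cutoffW_nonneg ((d₁ : ℝ) * d₂ * ((2 : ℝ) ^ i.1 * 2 ^ i.2) / 4 / qhat q ^ 2)
    positivity
  have hc : Continuous (Function.uncurry (boxWeight q d₁ d₂ α β r i)) :=
    (contDiff_uncurry_boxWeight hd₁ hd₂ hα hβ i).continuous
  exact (norm_fourier2_le (boxSupport_boxWeight i) hc ξ₁ ξ₂).trans
    (integral_integral_norm_boxWeight_le i hS0 (norm_boxWeight_le_of_twoSided hd₁ hd₂ i hJ0 hJ))

end TwoSided

/-! ### §3. The Bessel-sized bulk and per-box ledger -/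

section Bessel

variable {q d₁ d₂ α β r : ℕ}

/-- **Bulk with `J = 140·Z·(1+Z)^{−3/2}`**, `Z = 4π√(αβK₁K₂)/(qr)` (`q, r, α, β ≥ 1` so `Z > 0`).
[cite: Iwaniec2002, Appendix B.4 (B.35); KowalskiMichelVanderKam2000, (21)–(23) p. 12 — derivation] -/
theorem norm_fourier2_boxWeight_le_bessel [NeZero q] (hd₁ : 1 ≤ d₁) (hd₂ : 1 ≤ d₂) (hα : 1 ≤ α) (hβ : 1 ≤ β)
    (hr : 1 ≤ r) (i : ℕ × ℕ) (ξ₁ ξ₂ : ℝ) :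
    ‖fourier2 (boxWeight q d₁ d₂ α β r i) ξ₁ ξ₂‖ ≤
      9 / 4 * ((2 : ℝ) ^ i.1 * 2 ^ i.2) *
        (((d₁ : ℝ) * d₂ * ((2 : ℝ) ^ i.1 * 2 ^ i.2) / 4) ^ (-(1 / 2 : ℝ)) *
          cutoffW ((d₁ : ℝ) * d₂ * ((2 : ℝ) ^ i.1 * 2 ^ i.2) / 4 / qhat q ^ 2) * (r : ℝ)⁻¹ *
          (140 * (4 * π * Real.sqrt ((α : ℝ) * (β : ℝ) * ((2 : ℝ) ^ i.1 * 2 ^ i.2)) / ((q : ℝ) * r)) *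
            (1 + 4 * π * Real.sqrt ((α : ℝ) * (β : ℝ) * ((2 : ℝ) ^ i.1 * 2 ^ i.2)) / ((q : ℝ) * r)) ^
              (-(3 / 2 : ℝ)))) := by
  have hq0 : (0 : ℝ) < q := by exact_mod_cast Nat.pos_of_ne_zero (NeZero.ne q)
  have hr0 : (0 : ℝ) < r := by exact_mod_cast hr
  have hα0 : (0 : ℝ) < α := by exact_mod_cast hα
  have hβ0 : (0 : ℝ) < β := by exact_mod_cast hβ
  set Z : ℝ := 4 * π * Real.sqrt ((α : ℝ) * (β : ℝ) * ((2 : ℝ) ^ i.1 * 2 ^ i.2)) / ((q : ℝ) * r) with hZ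
  have hZ0 : 0 < Z := by
    have : 0 < Real.sqrt ((α : ℝ) * (β : ℝ) * ((2 : ℝ) ^ i.1 * 2 ^ i.2)) := Real.sqrt_pos.2 (by positivity)
    positivity
  refine norm_fourier2_boxWeight_le_twoSided hd₁ hd₂ hα hβ i (by positivity) (fun x hx1 hx2 ↦ ?_) ξ₁ ξ₂
  exact abs_besselJ_one_le_box hZ0 hx1 hx2

/-- **The per-box trivial ledger, Bessel-sized** (every stratum, centred count): for `q, d₁, d₂, α, β, r ≥ 1`,
`qr ∤ αβ`, the divisor bound `τ(n) ≤ Cn^δ`, and all `A₁, A₂`: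
`Σ_{box} ‖Φ̂_i(h/(qr))‖·N ≤ (9/4)K₁K₂·(d₁d₂K₁K₂/4)^{−1/2}W(X/4)r⁻¹·140Z(1+Z)^{−3/2} · gcd(α,qr)·(2A₁A₂/(qr)+1)·2C(A₁A₂)^δ`.
[cite: KowalskiMichelVanderKam2000, (21)–(23) p. 12 and Lemma 3.3 p. 9 — derivation] -/
theorem sum_dualBox_norm_le_bessel [NeZero q] [NeZero (q * r)] (hd₁ : 1 ≤ d₁) (hd₂ : 1 ≤ d₂) (hα : 1 ≤ α)
    (hβ : 1 ≤ β) (hr : 1 ≤ r) (hndvd : ¬ q * r ∣ α * β) (i : ℕ × ℕ) {δ C : ℝ} (hδ : 0 ≤ δ)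
    (hC : ∀ n : ℕ, ((n.divisors.card : ℕ) : ℝ) ≤ C * (n : ℝ) ^ δ) (A₁ A₂ : ℕ) :
    ∑ h ∈ (Finset.Icc (-(A₁ : ℤ)) A₁) ×ˢ (Finset.Icc (-(A₂ : ℤ)) A₂),
        ‖fourier2 (boxWeight q d₁ d₂ α β r i) (h.1 / (q * r : ℕ)) (h.2 / (q * r : ℕ))‖ *
          (dualCount (q * r) (α : ZMod (q * r)) (β : ZMod (q * r)) (h.1 : ZMod (q * r)) (h.2 : ZMod (q * r)) : ℝ) ≤
      (9 / 4 * ((2 : ℝ) ^ i.1 * 2 ^ i.2) *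
          (((d₁ : ℝ) * d₂ * ((2 : ℝ) ^ i.1 * 2 ^ i.2) / 4) ^ (-(1 / 2 : ℝ)) *
            cutoffW ((d₁ : ℝ) * d₂ * ((2 : ℝ) ^ i.1 * 2 ^ i.2) / 4 / qhat q ^ 2) * (r : ℝ)⁻¹ *
            (140 * (4 * π * Real.sqrt ((α : ℝ) * (β : ℝ) * ((2 : ℝ) ^ i.1 * 2 ^ i.2)) / ((q : ℝ) * r)) *
              (1 + 4 * π * Real.sqrt ((α : ℝ) * (β : ℝ) * ((2 : ℝ) ^ i.1 * 2 ^ i.2)) / ((q : ℝ) * r)) ^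
                (-(3 / 2 : ℝ))))) *
        ((Nat.gcd α (q * r) : ℝ) *
          ((2 * ((A₁ : ℝ) * A₂) / (q * r : ℕ) + 1) * (2 * C * ((A₁ : ℝ) * A₂) ^ δ))) := by
  have hq0 : (0 : ℝ) < q := by exact_mod_cast Nat.pos_of_ne_zero (NeZero.ne q)
  have hr0 : (0 : ℝ) < r := by exact_mod_cast hr
  have hα0 : (0 : ℝ) < α := by exact_mod_cast hα
  have hβ0 : (0 : ℝ) < β := by exact_mod_cast hβ
  have hZ0 : 0 < 4 * π * Real.sqrt ((α : ℝ) * (β : ℝ) * ((2 : ℝ) ^ i.1 * 2 ^ i.2)) / ((q : ℝ) * r) := by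
    have : 0 < Real.sqrt ((α : ℝ) * (β : ℝ) * ((2 : ℝ) ^ i.1 * 2 ^ i.2)) := Real.sqrt_pos.2 (by positivity)
    positivity
  set B : ℝ := 9 / 4 * ((2 : ℝ) ^ i.1 * 2 ^ i.2) *
    (((d₁ : ℝ) * d₂ * ((2 : ℝ) ^ i.1 * 2 ^ i.2) / 4) ^ (-(1 / 2 : ℝ)) *
      cutoffW ((d₁ : ℝ) * d₂ * ((2 : ℝ) ^ i.1 * 2 ^ i.2) / 4 / qhat q ^ 2) * (r : ℝ)⁻¹ *
      (140 * (4 * π * Real.sqrt ((α : ℝ) * (β : ℝ) * ((2 : ℝ) ^ i.1 * 2 ^ i.2)) / ((q : ℝ) * r)) *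
        (1 + 4 * π * Real.sqrt ((α : ℝ) * (β : ℝ) * ((2 : ℝ) ^ i.1 * 2 ^ i.2)) / ((q : ℝ) * r)) ^
          (-(3 / 2 : ℝ)))) with hB
  have hB0 : 0 ≤ B := by
    have := cutoffW_nonneg ((d₁ : ℝ) * d₂ * ((2 : ℝ) ^ i.1 * 2 ^ i.2) / 4 / qhat q ^ 2)
    positivity
  have hbulk : ∀ h : ℤ × ℤ, ‖fourier2 (boxWeight q d₁ d₂ α β r i) (h.1 / (q * r : ℕ)) (h.2 / (q * r : ℕ))‖ ≤ B :=
    fun h ↦ norm_fourier2_boxWeight_le_bessel hd₁ hd₂ hα hβ hr i _ _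
  have hcount := sum_dualCount_box_le_centred (c := q * r) α β hndvd A₁ A₂ hδ hC
  calc _ ≤ ∑ h ∈ (Finset.Icc (-(A₁ : ℤ)) A₁) ×ˢ (Finset.Icc (-(A₂ : ℤ)) A₂),
          B * (dualCount (q * r) (α : ZMod (q * r)) (β : ZMod (q * r)) (h.1 : ZMod (q * r))
            (h.2 : ZMod (q * r)) : ℝ) :=
        Finset.sum_le_sum fun h _ ↦ mul_le_mul_of_nonneg_right (hbulk h) (Nat.cast_nonneg _)
    _ = B * ∑ h ∈ (Finset.Icc (-(A₁ : ℤ)) A₁) ×ˢ (Finset.Icc (-(A₂ : ℤ)) A₂),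
          (dualCount (q * r) (α : ZMod (q * r)) (β : ZMod (q * r)) (h.1 : ZMod (q * r))
            (h.2 : ZMod (q * r)) : ℝ) := by rw [Finset.mul_sum]
    _ ≤ _ := mul_le_mul_of_nonneg_left hcount hB0

end Bessel

end Summit.Parity.GeneralizedHardyLittlewood.Theorems.BeyondDiagonalBeatsQuarter.OffDiag
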